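import Summits.QuantumFields.YangMills.Theorems.BalabanUVNodesN21ExpChartCoveringRadiusSharp

/-!
# N21 (NE7c) · THE SHARP COVERING RADIUS OF THE `SU(N)` EXPONENTIAL CHART, LOWER HALF AND HAAR READING: `ρ_N = 2π·√(⌊N/2⌋⌈N/2⌉/N)`
# is ATTAINED at the central element `e^{2πi⌊N/2⌋/N}·1` for EVERY `N ≥ 1` (`expBallSU S = SU(N) ⟺ ρ_N ≤ S`), and the window is a
# PROPER subset of `SU(N)` exactly below it: `Haar (g · exp B̄_S) < 1 ⟺ S < ρ_N`

Width seat pub-ymgap-dag-n21-w1 (g5; director-ym №197 ∕ HUMAN RULING D-0149), node N21 = NE7c (NOT PRINTED in [Bałaban 1983–89], NOT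
proved), lane K3⁸ `SpineGivenEndpointR13SepCoPHV` (stmt-QuantumFields-27366, KEY MAP v2; lineage K3⁷ stmt-QuantumFields-20544),
`--kind proof --supports … --as helper`.  File 33 of the seat's chain, companion of file 32 (`…N21ExpChartCoveringRadiusSharp`: every
`U ∈ SU(N)` is a chart point of norm `≤ ρ_N`).  THEOREMS ONLY: 0 `def`, 0 `sorry`; count-neutral.  Imports file 32 (hence files 18∕19∕23∕27 and
pub-balaban's chart modules).  NO Theses import.  Restates nothing; cites by name.  The radius is SPELLED OUT as
`2 * π * √((N/2 : ℕ) * (N − N/2 : ℕ) / N)`; no definition is introduced.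

THE MATHEMATICS ([folklore]).  (§1) Parity readings of the constant: `4⌊N/2⌋⌈N/2⌉ = N²` (even `N`) resp. `N² − 1` (odd `N`), so
`ρ_N = √N·π` (file 27's constant) resp. `π·√(N − 1/N)`, and `√2·π ≤ ρ_N ≤ √N·π` for `N ≥ 2` (`ρ_2 = √2·π` is file 24's A2; `ρ_3 = π·√(8/3)`,
`ρ_4 = 2π`).  (§2) File 27's ★ `sq_norm_ge_of_expPtSU_eq_centre` at `k = ⌊N/2⌋`: every logarithm of the central element `e^{2πi⌊N/2⌋/N}·1`
has `‖v‖² ≥ 4π²·⌊N/2⌋(N − ⌊N/2⌋)/N = ρ_N²` — for EVERY `N ≥ 1` (file 27 ★★ read it only at `N = 2k`); with file 32 ★★ the covering radius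
`sup_U inf {‖v‖ : expPtSU v = U}` is EXACTLY `ρ_N`, i.e. `expBallSU S = SU(N) ⟺ ρ_N ≤ S`.  (§3) The exponential image of the closed `S`-ball is
compact and the tree's Haar measure on `SU(N)` charges open sets (file 18), so `Haar (expBallSU S) < 1 ⟺ expBallSU S ≠ SU(N) ⟺ S < ρ_N`, and by
left invariance the same for every window `g · exp B̄_S`: the letter `hq : Haar (expWindowSU c S) < 1` of the chart road's LOCATED-1 certificates
(dag-n21-w2 p612378; file 18: `S ≤ π`; file 24: `S < √2·π`) holds for EXACTLY the radii `S < ρ_N`.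

WHAT IS PROVED ([folklore]).
* §1 `four_mul_half_mul_eq_of_even` ∕ `four_mul_half_mul_eq_of_odd` · `coveringRadius_eq_sqrt_mul_pi_of_even` (`ρ_N = √N·π`) ·
  `coveringRadius_eq_of_odd` (`ρ_N = π·√(N − 1/N)`) · `coveringRadius_le_sqrt_mul_pi` · `sqrt_two_mul_pi_le_coveringRadius` (`2 ≤ N`).
* §2 ★★ `exists_forall_expPtSU_eq_coveringRadius_le_norm` (every `N ≥ 1`: some `U` has NO logarithm of norm `< ρ_N`) ·
  `exists_not_mem_expBallSU_of_lt_coveringRadius` · `expBallSU_ne_univ_of_lt_coveringRadius` · ★★★ `expBallSU_eq_univ_iff`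
  (`0 < N`: `expBallSU S = univ ↔ ρ_N ≤ S`) · `expWindowSU_eq_univ_iff`.
* §3 `haar_compl_expBallSU_pos_of_lt_coveringRadius` · ★★ `haar_expBallSU_lt_one_of_lt_coveringRadius` · `haar_expWindowSU_lt_one_of_lt_coveringRadius` ·
  ★★★ `haar_expBallSU_lt_one_iff` · `haar_expWindowSU_lt_one_iff` (`Haar (g·exp B̄_S) < 1 ↔ S < ρ_N`, every centre `g`, every `N ≥ 1`) ·
  `haar_expBallSU_eq_one_iff`.

HONEST FRAMING.  [folklore] parity arithmetic and classical Haar-measure facts BY NAME over pub-balaban's chart modules and files 18∕27∕32; no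
located letter of any N21 road is touched; the application's window radius is a SMALL parameter, so this completes the SHARPNESS record of the
chart road (injectivity radius `√2·π`, files 23–26; covering radius `ρ_N`, files 27∕32∕33) — it is not a new located input; types nothing of
Bałaban's; (M1) ∕ NE7c NOT PRINTED ∕ NOT proved; **N21 NOT discharged**; K3⁸ NOT claimed; counts unmoved (typed 28∕28 · discharged 5∕27); never
a count claim; one finite 𝕋⁴ at fixed ε — R4 would close only the conditional finite-𝕋⁴ rung `BalabanLadder.UV`, NOT the Yang–Mills mass gap
(Clay); nothing about ℝ⁴ ∕ OS.  No decl below carries a cite tag.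
-/

set_option autoImplicit false

noncomputable section

open scoped BigOperators ENNReal
open MeasureTheory Set Function Metric Matrix Finset
open Complex (I)

namespace Summit.QuantumFields.YangMills.Theorems.N21ExpChartCoveringRadiusSharpHaar

open Literature.MathematicalPhysics.QuantumFieldTheory.Balaban1983to89
open Summit.QuantumFields.BalabanUV.T4Continuum
open Summit.QuantumFields.BalabanUV.T4Continuum.ShellMeasureExpChartSUN (SUN ChartSU expPtSU)
open Summit.QuantumFields.BalabanUV.T4Continuum.ShellMeasureScalingSUN
  (expBallSU expWindowSU measurableSet_expBallSU preimage_mul_expWindowSU)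
open Summit.QuantumFields.YangMills.Theorems.N21ExpWindowHaarMassLtOne (isCompact_expBallSU haar_isOpenPosMeasure haar_expWindowSU_eq)
open Summit.QuantumFields.YangMills.Theorems.N21ExpChartCoveringRadius (sq_norm_ge_of_expPtSU_eq_centre centre_mem_specialUnitaryGroup)
open Summit.QuantumFields.YangMills.Theorems.N21ExpChartCoveringRadiusSharp
  (expBallSU_eq_univ_of_coveringRadius_le haar_expBallSU_eq_one_of_coveringRadius_le)

variable {N : ℕ}

/-! ## §1 Reading the constant: `ρ_N = √N·π` (even `N`), `ρ_N = π·√(N − 1/N)` (odd `N`), `√2·π ≤ ρ_N ≤ √N·π` -/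

section Readings

/-- the parity reading, even case: `4·⌊N/2⌋·⌈N/2⌉ = N²`. [folklore] -/
theorem four_mul_half_mul_eq_of_even (h : Even N) : 4 * ((N / 2) * (N - N / 2)) = N * N := by
  obtain ⟨k, hk⟩ := h
  have h2 : N / 2 = k := by omega
  rw [h2, hk]
  have h3 : k + k - k = k := by omega
  rw [h3]
  ring

/-- the parity reading, odd case: `4·⌊N/2⌋·⌈N/2⌉ = N² − 1` (as `… + 1 = N²`). [folklore] -/
theorem four_mul_half_mul_eq_of_odd (h : Odd N) : 4 * ((N / 2) * (N - N / 2)) + 1 = N * N := by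
  obtain ⟨k, hk⟩ := h
  have h2 : N / 2 = k := by omega
  rw [h2, hk]
  have h3 : 2 * k + 1 - k = k + 1 := by omega
  rw [h3]
  ring

/-- **FOR EVEN `N` THE SHARP RADIUS IS FILE 27's `√N·π`**: `2π·√(⌊N/2⌋⌈N/2⌉/N) = √N·π`. [folklore] -/
theorem coveringRadius_eq_sqrt_mul_pi_of_even (h : Even N) :
    2 * Real.pi * Real.sqrt (((N / 2 : ℕ) : ℝ) * ((N - N / 2 : ℕ) : ℝ) / N) = Real.sqrt N * Real.pi := by
  have hsq : (2 * Real.pi) ^ 2 * (((N / 2 : ℕ) : ℝ) * ((N - N / 2 : ℕ) : ℝ) / N) = N * Real.pi ^ 2 := by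
    have h4 : (4 : ℝ) * (((N / 2 : ℕ) : ℝ) * ((N - N / 2 : ℕ) : ℝ)) = (N : ℝ) * N := by
      exact_mod_cast four_mul_half_mul_eq_of_even h
    rcases Nat.eq_zero_or_pos N with hN | hN
    · subst hN; simp
    · have hNr : (0 : ℝ) < N := by exact_mod_cast hN
      field_simp
      nlinarith [h4]
  rw [show 2 * Real.pi * Real.sqrt (((N / 2 : ℕ) : ℝ) * ((N - N / 2 : ℕ) : ℝ) / N) =
      Real.sqrt ((2 * Real.pi) ^ 2 * (((N / 2 : ℕ) : ℝ) * ((N - N / 2 : ℕ) : ℝ) / N)) by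
        rw [Real.sqrt_mul (sq_nonneg _), Real.sqrt_sq (by positivity)],
    hsq, Real.sqrt_mul (Nat.cast_nonneg N), Real.sqrt_sq Real.pi_pos.le]

/-- **FOR ODD `N` THE SHARP RADIUS IS `π·√(N − 1/N)`** (`= π·√((N² − 1)/N)`; strictly between file 27's lower bound at the centre and its
`√N·π`). [folklore] -/
theorem coveringRadius_eq_of_odd (h : Odd N) :
    2 * Real.pi * Real.sqrt (((N / 2 : ℕ) : ℝ) * ((N - N / 2 : ℕ) : ℝ) / N) = Real.pi * Real.sqrt (N - 1 / N) := by
  have hN : 0 < N := h.pos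
  have hNr : (0 : ℝ) < N := by exact_mod_cast hN
  have h4 : (4 : ℝ) * (((N / 2 : ℕ) : ℝ) * ((N - N / 2 : ℕ) : ℝ)) + 1 = (N : ℝ) * N := by
    exact_mod_cast four_mul_half_mul_eq_of_odd h
  have hsq : (2 : ℝ) ^ 2 * (((N / 2 : ℕ) : ℝ) * ((N - N / 2 : ℕ) : ℝ) / N) = N - 1 / N := by
    field_simp
    nlinarith [h4]
  rw [show 2 * Real.pi * Real.sqrt (((N / 2 : ℕ) : ℝ) * ((N - N / 2 : ℕ) : ℝ) / N) =
      Real.pi * (Real.sqrt ((2 : ℝ) ^ 2) * Real.sqrt (((N / 2 : ℕ) : ℝ) * ((N - N / 2 : ℕ) : ℝ) / N)) by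
        rw [Real.sqrt_sq zero_le_two]; ring,
    ← Real.sqrt_mul (sq_nonneg _), hsq]

/-- `ρ_N ≤ √N·π`: the sharp radius never exceeds file 27's (`4⌊N/2⌋⌈N/2⌉ ≤ N²`). [folklore] -/
theorem coveringRadius_le_sqrt_mul_pi :
    2 * Real.pi * Real.sqrt (((N / 2 : ℕ) : ℝ) * ((N - N / 2 : ℕ) : ℝ) / N) ≤ Real.sqrt N * Real.pi := by
  have h4 : (4 : ℝ) * (((N / 2 : ℕ) : ℝ) * ((N - N / 2 : ℕ) : ℝ)) ≤ (N : ℝ) * N := by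
    rcases Nat.even_or_odd N with h | h
    · exact (show _ = _ by exact_mod_cast four_mul_half_mul_eq_of_even h).le
    · have := (show (4 : ℝ) * (((N / 2 : ℕ) : ℝ) * ((N - N / 2 : ℕ) : ℝ)) + 1 = (N : ℝ) * N by
        exact_mod_cast four_mul_half_mul_eq_of_odd h)
      linarith
  have hsq : (2 * Real.pi) ^ 2 * (((N / 2 : ℕ) : ℝ) * ((N - N / 2 : ℕ) : ℝ) / N) ≤ N * Real.pi ^ 2 := by
    rcases Nat.eq_zero_or_pos N with hN | hN
    · subst hN; simp
    · have hNr : (0 : ℝ) < N := by exact_mod_cast hN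
      rw [mul_div_assoc', div_le_iff₀ hNr]
      nlinarith [h4, Real.pi_pos]
  rw [show 2 * Real.pi * Real.sqrt (((N / 2 : ℕ) : ℝ) * ((N - N / 2 : ℕ) : ℝ) / N) =
      Real.sqrt ((2 * Real.pi) ^ 2 * (((N / 2 : ℕ) : ℝ) * ((N - N / 2 : ℕ) : ℝ) / N)) by
        rw [Real.sqrt_mul (sq_nonneg _), Real.sqrt_sq (by positivity)],
    show Real.sqrt N * Real.pi = Real.sqrt (N * Real.pi ^ 2) by
        rw [Real.sqrt_mul (Nat.cast_nonneg N), Real.sqrt_sq Real.pi_pos.le]]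
  exact Real.sqrt_le_sqrt hsq

/-- `√2·π ≤ ρ_N` for `N ≥ 2` (`N ≤ 2⌊N/2⌋⌈N/2⌉`; equality at `N = 2`, file 24's A2): the injectivity radius of files 23–26 never
exceeds the covering radius. [folklore] -/
theorem sqrt_two_mul_pi_le_coveringRadius (hN : 2 ≤ N) :
    Real.sqrt 2 * Real.pi ≤ 2 * Real.pi * Real.sqrt (((N / 2 : ℕ) : ℝ) * ((N - N / 2 : ℕ) : ℝ) / N) := by
  have hNr : (0 : ℝ) < N := by exact_mod_cast (show 0 < N by omega)
  have h2 : N ≤ 2 * ((N / 2) * (N - N / 2)) := by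
    have hq : 1 ≤ N / 2 := by omega
    have hq' : N ≤ 2 * (N - N / 2) := by omega
    calc N ≤ 2 * (1 * (N - N / 2)) := by omega
      _ ≤ 2 * ((N / 2) * (N - N / 2)) := Nat.mul_le_mul_left _ (Nat.mul_le_mul_right _ hq)
  have h2r : (N : ℝ) ≤ 2 * (((N / 2 : ℕ) : ℝ) * ((N - N / 2 : ℕ) : ℝ)) := by exact_mod_cast h2
  have hsq : (Real.sqrt 2 * Real.pi) ^ 2 ≤ (2 * Real.pi) ^ 2 * (((N / 2 : ℕ) : ℝ) * ((N - N / 2 : ℕ) : ℝ) / N) := by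
    rw [mul_pow, Real.sq_sqrt zero_le_two, mul_div_assoc', le_div_iff₀ hNr]
    nlinarith [h2r, Real.pi_pos]
  have h0 : 0 ≤ 2 * Real.pi * Real.sqrt (((N / 2 : ℕ) : ℝ) * ((N - N / 2 : ℕ) : ℝ) / N) := by positivity
  refine (pow_le_pow_iff_left₀ (by positivity) h0 two_ne_zero).mp ?_
  calc (Real.sqrt 2 * Real.pi) ^ 2 ≤ (2 * Real.pi) ^ 2 * (((N / 2 : ℕ) : ℝ) * ((N - N / 2 : ℕ) : ℝ) / N) := hsq
    _ = (2 * Real.pi * Real.sqrt (((N / 2 : ℕ) : ℝ) * ((N - N / 2 : ℕ) : ℝ) / N)) ^ 2 := by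
        rw [mul_pow (2 * Real.pi), Real.sq_sqrt (by positivity)]


end Readings

/-! ## §2 The radius `ρ_N` is attained at the central element `e^{2πi⌊N/2⌋/N}·1` — for EVERY `N ≥ 1` -/

section Centre

/-- ★★ **FOR EVERY `N ≥ 1` THE RADIUS `ρ_N` IS ATTAINED**: the central element `e^{2πi⌊N/2⌋/N}·1 ∈ SU(N)` has NO logarithm in the chart of
Hilbert–Schmidt norm `< ρ_N = 2π·√(⌊N/2⌋⌈N/2⌉/N)` (file 27's ★ `sq_norm_ge_of_expPtSU_eq_centre` at `k = ⌊N/2⌋`; file 27 ★★ read it only at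
`N = 2k`).  With §2 the covering radius `sup_U inf {‖v‖ : expPtSU v = U}` of the trace-free exponential chart is EXACTLY `ρ_N` for every
`N`. [folklore] -/
theorem exists_forall_expPtSU_eq_coveringRadius_le_norm (hN : 0 < N) :
    ∃ U : SUN N, ∀ v : ChartSU N, expPtSU v = U →
      2 * Real.pi * Real.sqrt (((N / 2 : ℕ) : ℝ) * ((N - N / 2 : ℕ) : ℝ) / N) ≤ ‖v‖ := by
  refine ⟨⟨_, centre_mem_specialUnitaryGroup hN (N / 2)⟩, fun v hv => ?_⟩
  have h := sq_norm_ge_of_expPtSU_eq_centre hN (k := N / 2) (v := v) (by rw [hv])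
  have hcast : ((N - N / 2 : ℕ) : ℝ) = (N : ℝ) - ((N / 2 : ℕ) : ℝ) := by
    rw [Nat.cast_sub (Nat.div_le_self N 2)]
  have hsq : (2 * Real.pi * Real.sqrt (((N / 2 : ℕ) : ℝ) * ((N - N / 2 : ℕ) : ℝ) / N)) ^ 2 ≤ ‖v‖ ^ 2 := by
    rw [mul_pow, Real.sq_sqrt (by positivity), hcast]
    exact h
  exact (pow_le_pow_iff_left₀ (by positivity) (norm_nonneg v) two_ne_zero).mp hsq

/-- … hence for `N ≥ 1` and `S < ρ_N` some element of `SU(N)` lies outside `expBallSU S`. [folklore] -/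
theorem exists_not_mem_expBallSU_of_lt_coveringRadius (hN : 0 < N) {S : ℝ}
    (hS : S < 2 * Real.pi * Real.sqrt (((N / 2 : ℕ) : ℝ) * ((N - N / 2 : ℕ) : ℝ) / N)) :
    ∃ U : SUN N, U ∉ expBallSU S := by
  obtain ⟨U, hU⟩ := exists_forall_expPtSU_eq_coveringRadius_le_norm hN
  refine ⟨U, fun hmem => ?_⟩
  obtain ⟨v, hv, hvU⟩ := hmem
  have := hU v hvU
  have hv' := mem_closedBall_zero_iff.mp hv
  linarith

/-- … so NO window of radius `S < ρ_N` is the whole group (file 27: even `N`, `S < √N·π`). [folklore] -/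
theorem expBallSU_ne_univ_of_lt_coveringRadius (hN : 0 < N) {S : ℝ}
    (hS : S < 2 * Real.pi * Real.sqrt (((N / 2 : ℕ) : ℝ) * ((N - N / 2 : ℕ) : ℝ) / N)) :
    expBallSU (N := N) S ≠ univ := by
  obtain ⟨U, hU⟩ := exists_not_mem_expBallSU_of_lt_coveringRadius hN hS
  exact fun h => hU (h ▸ mem_univ U)

/-- ★★★ **THE COVERING RADIUS OF THE `SU(N)` EXPONENTIAL CHART IS EXACTLY `ρ_N = 2π·√(⌊N/2⌋⌈N/2⌉/N)`** (`N ≥ 1`): the exponential image of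
the closed Hilbert–Schmidt `S`-ball of `𝔰𝔲(N)` is all of `SU(N)` if and only if `ρ_N ≤ S`. [folklore] -/
theorem expBallSU_eq_univ_iff (hN : 0 < N) {S : ℝ} :
    expBallSU (N := N) S = univ ↔ 2 * Real.pi * Real.sqrt (((N / 2 : ℕ) : ℝ) * ((N - N / 2 : ℕ) : ℝ) / N) ≤ S := by
  constructor
  · intro h
    by_contra hS
    exact expBallSU_ne_univ_of_lt_coveringRadius hN (lt_of_not_ge hS) h
  · exact expBallSU_eq_univ_of_coveringRadius_le

/-- … and the same for every window `g · exp B̄_S`. [folklore] -/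
theorem expWindowSU_eq_univ_iff (hN : 0 < N) (g : SUN N) {S : ℝ} :
    expWindowSU g S = univ ↔ 2 * Real.pi * Real.sqrt (((N / 2 : ℕ) : ℝ) * ((N - N / 2 : ℕ) : ℝ) / N) ≤ S := by
  rw [← expBallSU_eq_univ_iff hN (S := S)]
  constructor
  · intro h
    have h1 : (fun h : SUN N => g * h) ⁻¹' expWindowSU g S = univ := by rw [h, preimage_univ]
    rwa [preimage_mul_expWindowSU] at h1
  · intro h
    rw [expWindowSU, h, image_univ]
    exact (Group.mulLeft_bijective g).surjective.range_eq

end Centre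

/-! ## §3 Properness of the window EXACTLY below the covering radius: `Haar (g · exp B̄_S) < 1 ⟺ S < ρ_N` -/

section Haar

variable [NeZero N]

/-- the complement of the exponential image ball has POSITIVE Haar mass for every `S < ρ_N` (file 18: `S ≤ π`; file 24: `S < √2·π`): it is
open (the ball's image is compact) and non-empty (§3). [folklore] -/
theorem haar_compl_expBallSU_pos_of_lt_coveringRadius {S : ℝ}
    (hS : S < 2 * Real.pi * Real.sqrt (((N / 2 : ℕ) : ℝ) * ((N - N / 2 : ℕ) : ℝ) / N)) :
    0 < (HaarData.haar : Measure (SUN N)) (expBallSU S)ᶜ := by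
  haveI := haar_isOpenPosMeasure (N := N)
  obtain ⟨U, hU⟩ := exists_not_mem_expBallSU_of_lt_coveringRadius (N := N) (NeZero.pos N) hS
  exact (isCompact_expBallSU S).isClosed.isOpen_compl.measure_pos _ ⟨U, hU⟩

/-- ★★ **THE EXPONENTIAL WINDOW HAS HAAR MASS `< 1` FOR EVERY RADIUS BELOW THE COVERING RADIUS**: `S < ρ_N ⇒ Haar (expBallSU S) < 1`
(every `N ≥ 1`; at `N = 1`, `ρ_1 = 0` and only the empty windows `S < 0` qualify — file 18's A2). [folklore] -/
theorem haar_expBallSU_lt_one_of_lt_coveringRadius {S : ℝ}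
    (hS : S < 2 * Real.pi * Real.sqrt (((N / 2 : ℕ) : ℝ) * ((N - N / 2 : ℕ) : ℝ) / N)) :
    (HaarData.haar : Measure (SUN N)) (expBallSU S) < 1 := by
  haveI : IsProbabilityMeasure (HaarData.haar : Measure (SUN N)) := HaarData.isProb
  have hadd : (HaarData.haar : Measure (SUN N)) (expBallSU S) + (HaarData.haar : Measure (SUN N)) (expBallSU S)ᶜ = 1 := by
    rw [measure_add_measure_compl (measurableSet_expBallSU S), measure_univ]
  calc (HaarData.haar : Measure (SUN N)) (expBallSU S)
      < (HaarData.haar : Measure (SUN N)) (expBallSU S) + (HaarData.haar : Measure (SUN N)) (expBallSU S)ᶜ :=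
        ENNReal.lt_add_right (measure_ne_top _ _) (haar_compl_expBallSU_pos_of_lt_coveringRadius hS).ne'
    _ = 1 := hadd

/-- ★★ … and so has EVERY WINDOW `g · exp B̄_S`, `S < ρ_N` (left invariance, file 18's `haar_expWindowSU_eq`). [folklore] -/
theorem haar_expWindowSU_lt_one_of_lt_coveringRadius (g : SUN N) {S : ℝ}
    (hS : S < 2 * Real.pi * Real.sqrt (((N / 2 : ℕ) : ℝ) * ((N - N / 2 : ℕ) : ℝ) / N)) :
    (HaarData.haar : Measure (SUN N)) (expWindowSU g S) < 1 := by
  rw [haar_expWindowSU_eq]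
  exact haar_expBallSU_lt_one_of_lt_coveringRadius hS

/-- ★★★ **PROPERNESS EXACTLY BELOW THE COVERING RADIUS**: `Haar (expBallSU S) < 1 ⟺ S < ρ_N` (every `N ≥ 1`) — the letter `hq` of the chart
road's LOCATED-1 certificates (dag-n21-w2 p612378 ∕ file 18 ∕ file 21) holds for exactly these radii. [folklore] -/
theorem haar_expBallSU_lt_one_iff {S : ℝ} :
    (HaarData.haar : Measure (SUN N)) (expBallSU S) < 1 ↔
      S < 2 * Real.pi * Real.sqrt (((N / 2 : ℕ) : ℝ) * ((N - N / 2 : ℕ) : ℝ) / N) := by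
  constructor
  · intro h
    by_contra hS
    rw [haar_expBallSU_eq_one_of_coveringRadius_le (le_of_not_gt hS)] at h
    exact lt_irrefl _ h
  · exact haar_expBallSU_lt_one_of_lt_coveringRadius

/-- … `Haar (g · exp B̄_S) < 1 ⟺ S < ρ_N` for every centre `g`. [folklore] -/
theorem haar_expWindowSU_lt_one_iff (g : SUN N) {S : ℝ} :
    (HaarData.haar : Measure (SUN N)) (expWindowSU g S) < 1 ↔
      S < 2 * Real.pi * Real.sqrt (((N / 2 : ℕ) : ℝ) * ((N - N / 2 : ℕ) : ℝ) / N) := by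
  rw [haar_expWindowSU_eq]
  exact haar_expBallSU_lt_one_iff

/-- … equivalently `Haar (expBallSU S) = 1 ⟺ ρ_N ≤ S`. [folklore] -/
theorem haar_expBallSU_eq_one_iff {S : ℝ} :
    (HaarData.haar : Measure (SUN N)) (expBallSU S) = 1 ↔
      2 * Real.pi * Real.sqrt (((N / 2 : ℕ) : ℝ) * ((N - N / 2 : ℕ) : ℝ) / N) ≤ S := by
  constructor
  · intro h
    by_contra hS
    have := haar_expBallSU_lt_one_of_lt_coveringRadius (N := N) (lt_of_not_ge hS)
    rw [h] at this
    exact lt_irrefl _ this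
  · exact haar_expBallSU_eq_one_of_coveringRadius_le

end Haar

end Summit.QuantumFields.YangMills.Theorems.N21ExpChartCoveringRadiusSharpHaar

end
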